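import Literature.Analysis.FluidPDE.SecondDifferenceIntegralTubeHolomorphy
import Literature.Analysis.Complex.OsgoodProofs
import Mathlib.Analysis.Calculus.ContDiff.RestrictScalars
import Mathlib.Analysis.Calculus.ContDiff.Bounds
import Mathlib.Analysis.Complex.Exponential
import HarnessLib

/-!
# Cauchy estimates for the real slice of a bounded tube-holomorphic map

Analysis/FluidPDE proof file (theorems only: no definitions, no named facts, no `sorry`).

If `U : ℂ^ι → ℂ^κ` is holomorphic on the complex tube `complexTube ι r` (`|Im z| < r`) and bounded there by `B`, and
`f : ℝ^ι → ℝ^κ` is its real slice (`U (complexify x) = complexify (f x)`), then ALL real Fréchet derivatives of `f` obey the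
Cauchy estimates

  `‖Dʲ f (x)‖ ≤ B · (2(j+1)/r)ʲ ≤ B · e · (2e/r)ʲ · j!`   for every `j` and every `x ∈ ℝ^ι`

(`norm_iteratedFDeriv_slice_le_of_tube`, `norm_iteratedFDeriv_slice_le_factorial_of_tube`).  This is the quantitative form in
which the analyticity radius of Navier–Stokes slices (Guberović 2010 / Grujić–Kukavica 1998, tree:
`guberovic2010_analyticity_radius_holds`, `Grujic2013.hasAnalyticRestarts_of_classical`) enters derivative bookkeeping
(factorial budgets `‖Dʲv‖ ≤ j!ρ^{-j}Mλ^{-j}`).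

Proof: the closed complex ball of radius `r/2` about a real point lies in the tube (`add_mem_complexTube_of_norm_lt`); the
operator-norm Cauchy estimates for holomorphic maps of several variables (Hörmander, Thm. 2.2.7; tree
`Complex.SCV.norm_iteratedFDeriv_le_of_closedBall`, with step `δ = (r/2)/(j+1)`) bound `‖Dʲ_ℂ U‖` at the real point; the real
derivatives of `f = P ∘ U ∘ complexify` (`P` = coordinatewise real part, `‖P‖ ≤ 1`, `complexify` a real-linear isometry) are
controlled by `ContinuousLinearMap.norm_iteratedFDeriv_comp_left`, `ContinuousLinearMap.iteratedFDerivWithin_comp_right` and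
`ContDiffAt.restrictScalars_iteratedFDeriv` (`‖·‖` is unchanged by restriction of scalars); finally `(j+1)ʲ ≤ e^{j+1} j!`
(`Real.pow_div_factorial_le_exp`).

## References
* L. Hörmander, *An Introduction to Complex Analysis in Several Variables* (1973), Thm. 2.2.7 (Cauchy's inequalities). [HormanderSCV1973]
-/

noncomputable section

open Set Metric Function
open scoped Nat
open Literature.Analysis.FunctionSpaces.EuclideanSpace (complexify complexify_apply norm_complexify)

namespace Literature.Analysis.FluidPDE

variable {ι κ : Type*} [Fintype ι] [Fintype κ]

/-- The closed complex ball of radius `r/2` about a real point lies in the tube of radius `r`. [folklore] -/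
private theorem closedBall_complexify_subset_complexTube {r : ℝ} (hr : 0 < r) (x : EuclideanSpace ℝ ι) :
    closedBall (complexify x) (r / 2) ⊆ complexTube ι r := by
  intro w hw
  have hx : complexify x ∈ complexTube ι (r / 4) := complexify_mem_complexTube (by positivity) x
  have hh : ‖w - complexify x‖ < 3 * r / 4 := by
    rw [mem_closedBall, dist_eq_norm] at hw
    linarith
  have h := add_mem_complexTube_of_norm_lt hx hh
  rw [add_sub_cancel, show r / 4 + 3 * r / 4 = r by ring] at h
  exact h

/-- A real-linear left inverse of `complexify : ℝ^κ → ℂ^κ` (coordinatewise real part) of operator norm `≤ 1`. [folklore] -/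
private theorem exists_clm_leftInverse_complexify_norm_le :
    ∃ P : EuclideanSpace ℂ κ →L[ℝ] EuclideanSpace ℝ κ, ‖P‖ ≤ 1 ∧ ∀ v : EuclideanSpace ℝ κ, P (complexify v) = v := by
  let L : EuclideanSpace ℂ κ →ₗ[ℝ] EuclideanSpace ℝ κ :=
    { toFun := fun w => WithLp.toLp 2 fun i => (w i).re
      map_add' := fun v w => by ext i; simp
      map_smul' := fun t w => by ext i; simp }
  have hL : ∀ w, ‖L w‖ ≤ 1 * ‖w‖ := by
    intro w
    rw [one_mul, EuclideanSpace.norm_eq (L w), EuclideanSpace.norm_eq w]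
    refine Real.sqrt_le_sqrt (Finset.sum_le_sum fun i _ => ?_)
    simp only [L, LinearMap.coe_mk, AddHom.coe_mk, PiLp.toLp_apply, Real.norm_eq_abs]
    exact pow_le_pow_left₀ (abs_nonneg _) (Complex.abs_re_le_norm _) 2
  refine ⟨L.mkContinuous 1 hL, L.mkContinuous_norm_le zero_le_one hL, fun v => ?_⟩
  ext i
  simp [L, complexify_apply]

/-- **Cauchy estimates for the real slice of a bounded tube-holomorphic map** (Hörmander, Thm. 2.2.7, restricted to real
points): if `U` is holomorphic on `complexTube ι r`, `‖U‖ ≤ B` there, and `U (complexify x) = complexify (f x)` for all real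
`x`, then `‖Dʲ f (x)‖ ≤ B · (2(j+1)/r)ʲ` for every `j` and `x`. [cite: HormanderSCV1973, Thm 2.2.7] -/
theorem norm_iteratedFDeriv_slice_le_of_tube {r B : ℝ} (hr : 0 < r)
    {U : EuclideanSpace ℂ ι → EuclideanSpace ℂ κ} {f : EuclideanSpace ℝ ι → EuclideanSpace ℝ κ}
    (hU : DifferentiableOn ℂ U (complexTube ι r)) (hUf : ∀ x, U (complexify x) = complexify (f x))
    (hB : ∀ z ∈ complexTube ι r, ‖U z‖ ≤ B) (j : ℕ) (x : EuclideanSpace ℝ ι) :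
    ‖iteratedFDeriv ℝ j f x‖ ≤ B * (2 * ((j : ℝ) + 1) / r) ^ j := by
  have hopen : IsOpen (complexTube ι r) := isOpen_complexTube r
  set z₀ : EuclideanSpace ℂ ι := complexify x with hz₀
  have hz₀mem : z₀ ∈ complexTube ι r := complexify_mem_complexTube hr x
  -- (1) complex Cauchy estimate at the real point, step `δ = (r/2)/(j+1)`
  have hsub : closedBall z₀ (r / 2) ⊆ complexTube ι r := closedBall_complexify_subset_complexTube hr x
  have hM : ∀ z ∈ closedBall z₀ (r / 2), ‖U z‖ ≤ B := fun z hz => hB z (hsub hz)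
  set δ : ℝ := r / 2 / ((j : ℝ) + 1) with hδdef
  have hδ : 0 < δ := by positivity
  have hjδ : (j : ℝ) * δ ≤ r / 2 := by
    rw [hδdef, mul_div_assoc', div_le_iff₀ (by positivity)]
    nlinarith [hr]
  have hx' : z₀ ∈ closedBall z₀ (r / 2 - j * δ) := mem_closedBall_self (by linarith)
  have hC : ‖iteratedFDeriv ℂ j U z₀‖ ≤ B / δ ^ j :=
    Literature.Analysis.Complex.SCV.norm_iteratedFDeriv_le_of_closedBall hU hopen hsub hM hδ j hjδ hx'
  -- (2) real derivatives of `U` at `z₀`: restriction of scalars does not change the norm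
  have hUan : AnalyticAt ℂ U z₀ := Literature.Analysis.Complex.SCV.analyticAt_of_differentiableOn hU hopen hz₀mem
  have hUcd : ContDiffAt ℂ (j : ℕ∞) U z₀ := hUan.contDiffAt.of_le le_top
  have hrs : ‖iteratedFDeriv ℝ j U z₀‖ = ‖iteratedFDeriv ℂ j U z₀‖ := by
    rw [← hUcd.restrictScalars_iteratedFDeriv (𝕜 := ℝ), Function.comp_apply,
      ContinuousMultilinearMap.norm_restrictScalars]
  -- (3) composition with `complexify` on the right (within the tube, whose real preimage is everything)
  set g : EuclideanSpace ℝ ι →L[ℝ] EuclideanSpace ℂ ι :=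
    (complexify : EuclideanSpace ℝ ι →ₗᵢ[ℝ] EuclideanSpace ℂ ι).toContinuousLinearMap with hgdef
  have hg1 : ‖g‖ ≤ 1 := (complexify : EuclideanSpace ℝ ι →ₗᵢ[ℝ] EuclideanSpace ℂ ι).norm_toContinuousLinearMap_le
  have hgx : ∀ y, g y = complexify y := fun y => rfl
  have hpre : g ⁻¹' complexTube ι r = univ := by
    ext y
    simp only [mem_preimage, mem_univ, iff_true]
    rw [hgx]; exact complexify_mem_complexTube hr y
  have hUcdOn : ContDiffOn ℝ (j : ℕ∞) U (complexTube ι r) :=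
    ((Literature.Analysis.Complex.SCV.contDiffOn_infty hU hopen).of_le (by exact_mod_cast le_top)).restrict_scalars ℝ
  have hcomp : iteratedFDeriv ℝ j (U ∘ g) x =
      (iteratedFDeriv ℝ j U z₀).compContinuousLinearMap fun _ => g := by
    have h := g.iteratedFDerivWithin_comp_right (i := j) hUcdOn hopen.uniqueDiffOn
      (by rw [hpre]; exact uniqueDiffOn_univ) (x := x) (by rw [hgx]; exact hz₀mem) le_rfl
    rw [hpre, iteratedFDerivWithin_univ, iteratedFDerivWithin_of_isOpen j hopen (by rw [hgx]; exact hz₀mem)] at h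
    rw [h]
    rfl
  have hUg : ‖iteratedFDeriv ℝ j (U ∘ g) x‖ ≤ B / δ ^ j := by
    rw [hcomp]
    refine (ContinuousMultilinearMap.norm_compContinuousLinearMap_le _ _).trans ?_
    rw [Finset.prod_const, Finset.card_univ, Fintype.card_fin, hrs]
    calc ‖iteratedFDeriv ℂ j U z₀‖ * ‖g‖ ^ j ≤ B / δ ^ j * 1 ^ j := by
          refine mul_le_mul hC (pow_le_pow_left₀ (norm_nonneg _) hg1 j) (by positivity) ?_
          exact (norm_nonneg _).trans hC
      _ = B / δ ^ j := by rw [one_pow, mul_one]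
  -- (4) composition with the real part `P` on the left: `f = P ∘ U ∘ complexify`
  obtain ⟨P, hP1, hP⟩ := exists_clm_leftInverse_complexify_norm_le (κ := κ)
  have hfP : f = P ∘ (U ∘ g) := by
    funext y
    simp only [Function.comp_apply, hgx, hUf, hP]
  have hUgcd : ContDiffAt ℝ (j : ℕ∞) (U ∘ g) x :=
    (hUcd.restrict_scalars ℝ).comp x (g.contDiff.contDiffAt)
  have hfinal : ‖iteratedFDeriv ℝ j f x‖ ≤ B / δ ^ j := by
    rw [hfP]
    refine (P.norm_iteratedFDeriv_comp_left hUgcd le_rfl).trans ?_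
    calc ‖P‖ * ‖iteratedFDeriv ℝ j (U ∘ g) x‖ ≤ 1 * (B / δ ^ j) :=
          mul_le_mul hP1 hUg (norm_nonneg _) zero_le_one
      _ = B / δ ^ j := one_mul _
  -- (5) `B / δʲ = B (2(j+1)/r)ʲ`
  refine hfinal.trans (le_of_eq ?_)
  rw [hδdef, div_div, div_eq_mul_inv B, ← inv_pow, inv_div, mul_comm (2 : ℝ) ((j : ℝ) + 1)]

/-- The same Cauchy estimate in FACTORIAL form: `‖Dʲ f (x)‖ ≤ B · e · (2e/r)ʲ · j!` (`(j+1)ʲ ≤ e^{j+1} j!`). This is the shape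
`j! · ρ^{-j}` of analytic derivative budgets. [cite: HormanderSCV1973, Thm 2.2.7] -/
theorem norm_iteratedFDeriv_slice_le_factorial_of_tube {r B : ℝ} (hr : 0 < r)
    {U : EuclideanSpace ℂ ι → EuclideanSpace ℂ κ} {f : EuclideanSpace ℝ ι → EuclideanSpace ℝ κ}
    (hU : DifferentiableOn ℂ U (complexTube ι r)) (hUf : ∀ x, U (complexify x) = complexify (f x))
    (hB : ∀ z ∈ complexTube ι r, ‖U z‖ ≤ B) (j : ℕ) (x : EuclideanSpace ℝ ι) :
    ‖iteratedFDeriv ℝ j f x‖ ≤ B * Real.exp 1 * (2 * Real.exp 1 / r) ^ j * j ! := by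
  have h := norm_iteratedFDeriv_slice_le_of_tube hr hU hUf hB j x
  have hB0 : 0 ≤ B := (norm_nonneg _).trans (hB _ (complexify_mem_complexTube hr x))
  -- `(j+1)^j ≤ e^{j+1} j!`
  have hexp : ((j : ℝ) + 1) ^ j ≤ Real.exp 1 * Real.exp 1 ^ j * j ! := by
    have h1 := Real.pow_div_factorial_le_exp ((j : ℝ) + 1) (by positivity) j
    rw [div_le_iff₀ (by positivity)] at h1
    have h2 : Real.exp ((j : ℝ) + 1) = Real.exp 1 * Real.exp 1 ^ j := by
      rw [Real.exp_add, ← Real.exp_nat_mul, mul_one, mul_comm]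
    calc ((j : ℝ) + 1) ^ j ≤ Real.exp ((j : ℝ) + 1) * j ! := h1
      _ = Real.exp 1 * Real.exp 1 ^ j * j ! := by rw [h2]
  calc ‖iteratedFDeriv ℝ j f x‖ ≤ B * (2 * ((j : ℝ) + 1) / r) ^ j := h
    _ = B * ((2 / r) ^ j * ((j : ℝ) + 1) ^ j) := by rw [← mul_pow]; ring
    _ ≤ B * ((2 / r) ^ j * (Real.exp 1 * Real.exp 1 ^ j * j !)) := by
        gcongr
    _ = B * Real.exp 1 * (2 * Real.exp 1 / r) ^ j * j ! := by
        rw [show 2 * Real.exp 1 / r = 2 / r * Real.exp 1 by ring, mul_pow]; ring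

end Literature.Analysis.FluidPDE

end
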